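import Summits.AtomisticToContinuum.Crystallization.Theorems.FrustratedLawDichotomyAperiodicGapUnitDenseDifferences
import Summits.AtomisticToContinuum.Crystallization.Theorems.FrustratedLawDichotomyBornStability
import Summits.AtomisticToContinuum.Crystallization.Theorems.FrustratedLawDichotomyNoRattlers
import Summits.AtomisticToContinuum.Crystallization.Theorems.FrustratedLawDichotomyAperiodicGapCompressedCut

/-!
# FrustratedLawDichotomy · crux `AperiodicFrustratedLawGap` (stmt-AtomisticToContinuum-27623) — THE CORE OF RECORD, FINAL FORM OF GENERATION 2
# (decomp-a2c, prover hand 2)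

`aperiodicFrustratedLawGap_iff_core_final`: granted the floor of item 9229 (hypothesis `hU`), the crux (route decl, BY NAME) is EQUIVALENT to its
restriction to laws satisfying ALL EIGHT landed necessary conditions on exact Lennard-Jones minimisers among point-stationary hard-core laws:
(i) a.s. a 1-RELATIVELY-DENSE difference set (`…UnitDenseDifferences`, sharpening generation 0's 2), (ii) zero Palm pressure, (iii) the energy
identity `E[rootEnergy] = −(1/24)∫∫‖y‖⁻¹²`, (iv) stability under `GL₃(ℝ)`, (v) zero Palm stress tensor, (vi) Born stability, (vii) a compressed root
with positive probability, (viii) no rattlers (`δR > 10`).  This single statement is the residual of record handed to the planner.  [folklore]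
-/

noncomputable section

namespace Summit.AtomisticToContinuum.Crystallization.Theorems.FrustratedLawDichotomyAperiodicGapVirialCut

open MeasureTheory
open Summit.AtomisticToContinuum.Crystallization.Theorems.FrustratedLawDichotomyThinning (ae_forall_crowded_of_minimising)
open Summit.AtomisticToContinuum.Crystallization.Theorems.FrustratedLawDichotomyVirial (virial_of_minimising')
open Summit.AtomisticToContinuum.Crystallization.Theorems.FrustratedLawDichotomyLinearImages (eStar_le_integral_linearDeformed)
open Summit.AtomisticToContinuum.Crystallization.Theorems.FrustratedLawDichotomyPalmStress (palmStress_of_minimising bornStability_of_minimising)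
open Summit.AtomisticToContinuum.Crystallization.Theorems.FrustratedLawDichotomyAperiodicGapFiniteCut (aperiodicFrustratedLawGap_iff_unitDenseDifferences)

/-- **THE CORE OF RECORD, FINAL FORM (hand 2, generations 0–2).**  Granted the floor of item 9229, `AperiodicFrustratedLawGap` (by name) is
EQUIVALENT to its restriction to laws with a 1-relatively-dense difference set, zero Palm pressure, the energy identity, `GL₃`-stability, zero
Palm stress tensor, Born stability, a compressed root with positive probability and no rattlers. [folklore] -/
theorem aperiodicFrustratedLawGap_iff_core_final
    (hU : ∀ δ' : ℝ, 0 < δ' → ∀ Q : MeasureTheory.Measure (MeasureTheory.Measure (EuclideanSpace ℝ (Fin 3))), MeasureTheory.IsProbabilityMeasure Q →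
      (∀ᵐ μ ∂Q, Literature.Probability.Process.IsRootedHardCore δ' μ) → Literature.Probability.Process.IsPointStationaryLaw Q →
      (⨅ Q : Literature.MathematicalPhysics.StatisticalMechanics.PeriodicConfiguration 3, Q.energyPerParticle Literature.MathematicalPhysics.StatisticalMechanics.lennardJones) ≤
        ∫ μ, Literature.MathematicalPhysics.StatisticalMechanics.rootEnergy Literature.MathematicalPhysics.StatisticalMechanics.lennardJones μ ∂Q) :
    Summit.AtomisticToContinuum.Crystallization.Theses.FrustratedLawDichotomy.AperiodicFrustratedLawGap ↔
    (∀ δ : ℝ, 0 < δ → ∀ P : MeasureTheory.Measure (MeasureTheory.Measure (EuclideanSpace ℝ (Fin 3))), let Gy : ℝ → (N : ℕ) → (Fin N → EuclideanSpace ℝ (Fin 3)) → Fin N → Prop := fun η N y j => let d : ℝ := sInf ((fun z => dist z (y (j : Fin N))) '' (Set.range (y) \ {(y (j : Fin N))})); let T : Set (EuclideanSpace ℝ (Fin 3)) := {z : EuclideanSpace ℝ (Fin 3) | z ∈ Set.range (y) ∧ z ≠ (y (j : Fin N)) ∧ dist z (y (j : Fin N)) < 13 / 10 * d}; ∃ A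 : EuclideanSpace ℝ (Fin 3) →ₗᵢ[ℝ] EuclideanSpace ℝ (Fin 3), (∃ e : ↥T ≃ ↥Literature.Geometry.DiscreteGeometry.fccKissingPattern, ∀ t : ↥T, dist (d⁻¹ • ((t : EuclideanSpace ℝ (Fin 3)) - (y (j : Fin N)))) (A ((e t : ↥Literature.Geometry.DiscreteGeometry.fccKissingPattern) : EuclideanSpace ℝ (Fin 3))) ≤ η) ∨ (∃ e : ↥T ≃ ↥Literature.Geometry.DiscreteGeometry.hcpKissingPattern, ∀ t : ↥T, dist (d⁻¹ • ((t : EuclideanSpace ℝ (Fin 3)) - (y (j : Fin N)))) (A ((e t : ↥Literature.Geometry.DiscreteGeometry.hcpKissingPattern) : EuclideanSpace ℝ (Fin 3))) ≤ η); let TexBall : (N : ℕ) → (Fin N → EuclideanSpace ℝ (Fin 3)) → Fin N → ℝ → ℝ → ℝ → ℝ → Prop := fun N y i R R₇ R₈ R₉ => (∀ a b : Fin N, a ≠ b → (7 : ℝ) / 10 ≤ dist (y a) (y b)) ∧ (∀ j : Fin N, dist (y j) (y i) ≤ R → ¬ Gy (1 / 20) N (y) j) ∧ (∀ j : Fin N,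 dist (y j) (y i) ≤ R → ¬ ((∀ j' : Fin N, dist (y j') (y j) ≤ R₇ → ¬ Gy (1 / 20) N (y) j') ∧ (∀ z : EuclideanSpace ℝ (Fin 3), dist z (y j) ≤ R₇ → ∃ k : Fin N, dist z (y k) ≤ 1) ∧ (∀ j' : Fin N, dist (y j') (y j) ≤ R₇ → (let d : ℝ := sInf ((fun z => dist z (y j')) '' (Set.range (y) \ {(y j')})); ∀ k : Fin N, y k ≠ y j' → dist (y k) (y j') < 27 / 20 * d → 5 ≤ Nat.card {m : Fin N // y m ≠ y j' ∧ dist (y m) (y j') < 27 / 20 * d ∧ y m ≠ y k ∧ dist (y m) (y k) < 27 / 20 * d})))) ∧ (∀ j : Fin N, dist (y j) (y i) ≤ R → ∃ k : Fin N, dist (y k) (y j) ≤ R₈ ∧ Gy (1 / 8) N (y) k) ∧ (∀ j : Fin N, dist (y j) (y i) ≤ R → ¬ ((∀ j' : Fin N, dist (y j') (y j) ≤ R₉ → ¬ Gy (1 / 20) N (y) j') ∧ (Nat.card {j' : Fin N // dist (y j') (y j) ≤ R₉ ∧ ¬ Gy (1 / 8) N (y) j'} : ℝ) ≤ 1 /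 2 * (Nat.card {j' : Fin N // dist (y j') (y j) ≤ R₉} : ℝ) ∧ (∀ j' : Fin N, dist (y j') (y j) ≤ R₉ → ¬ Gy (1 / 8) N (y) j' → ¬ (let d : ℝ := sInf ((fun z => dist z (y j')) '' (Set.range (y) \ {(y j')})); ∀ k : Fin N, y k ≠ y j' → dist (y k) (y j') < 27 / 20 * d → 5 ≤ Nat.card {m : Fin N // y m ≠ y j' ∧ dist (y m) (y j') < 27 / 20 * d ∧ y m ≠ y k ∧ dist (y m) (y k) < 27 / 20 * d})))); let Appr : MeasureTheory.Measure (EuclideanSpace ℝ (Fin 3)) → ℝ → ℝ → ℝ → Prop := fun μ R₇ R₈ R₉ => ∀ q : EuclideanSpace ℝ (Fin 3), μ {q} ≠ 0 → ∀ R ε : ℝ, 0 < ε → ∃ (N : ℕ) (y : Fin N → EuclideanSpace ℝ (Fin 3)) (i : Fin N), TexBall N y i R R₇ R₈ R₉ ∧ (∀ p : EuclideanSpace ℝ (Fin 3), μ {p} ≠ 0 → dist p q ≤ R → ∃ k : Fin N, dist (y k - y i) (p - q) ≤ ε) ∧ (∀ k : Fin N, dist (y k) (y i) ≤ R → ∃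 p : EuclideanSpace ℝ (Fin 3), μ {p} ≠ 0 ∧ dist (y k - y i) (p - q) ≤ ε); MeasureTheory.IsProbabilityMeasure P → (∀ᵐ μ ∂P, Literature.Probability.Process.IsRootedHardCore δ μ) → Literature.Probability.Process.IsPointStationaryLaw P → (∃ R₇ R₈ R₉ : ℝ, ∀ᵐ μ ∂P, Appr μ R₇ R₈ R₉) → (∀ᵐ μ ∂P, ∀ p : EuclideanSpace ℝ (Fin 3), μ {p} ≠ 0 → ∀ y : EuclideanSpace ℝ (Fin 3), (∀ q : EuclideanSpace ℝ (Fin 3), μ {q} ≠ 0 → q ≠ p → y ≠ q) → ∑' q : {q : EuclideanSpace ℝ (Fin 3) // μ {q} ≠ 0 ∧ q ≠ p}, Literature.MathematicalPhysics.StatisticalMechanics.lennardJones (dist p (q : EuclideanSpace ℝ (Fin 3))) ≤ ∑' q : {q : EuclideanSpace ℝ (Fin 3) // μ {q} ≠ 0 ∧ q ≠ p}, Literature.MathematicalPhysics.StatisticalMechanics.lennardJones (dist y (q : EuclideanSpace ℝ (Fin 3)))) → P {μ : MeasureTheory.Measure (EuclideanSpace ℝ (Fin 3)) | ∃ Q :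 Literature.MathematicalPhysics.StatisticalMechanics.PeriodicConfiguration 3, ∃ t : EuclideanSpace ℝ (Fin 3), {p : EuclideanSpace ℝ (Fin 3) | μ {p} ≠ 0} = (fun s => s + t) '' Q.points} = 0 → (∀ᵐ μ ∂P, ∀ v : EuclideanSpace ℝ (Fin 3), ∀ ε : ℝ, 0 < ε → ∃ s s' : EuclideanSpace ℝ (Fin 3), μ {s} ≠ 0 ∧ μ {s'} ≠ 0 ∧ ‖s - s' + v‖ < 1 + ε) → (∫ μ, ∫ y, ‖y‖⁻¹ ^ 6 ∂μ ∂P = ∫ μ, ∫ y, ‖y‖⁻¹ ^ 12 ∂μ ∂P) → ((∫ μ, Literature.MathematicalPhysics.StatisticalMechanics.rootEnergy Literature.MathematicalPhysics.StatisticalMechanics.lennardJones μ ∂P) = -(1 / 24) * ∫ μ, ∫ y, ‖y‖⁻¹ ^ 12 ∂μ ∂P) → (∀ A : EuclideanSpace ℝ (Fin 3) ≃L[ℝ] EuclideanSpace ℝ (Fin 3), (∫ μ, Literature.MathematicalPhysics.StatisticalMechanics.rootEnergy Literature.MathematicalPhysics.StatisticalMechanics.lennardJones μ ∂P) ≤ ∫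 μ, (∫ y, Literature.MathematicalPhysics.StatisticalMechanics.lennardJones ‖A y‖ ∂μ) / 2 ∂P) → (∀ Hm : EuclideanSpace ℝ (Fin 3) →L[ℝ] EuclideanSpace ℝ (Fin 3), (∫ μ, ∫ y, (‖y‖⁻¹ ^ 8 - ‖y‖⁻¹ ^ 14) * inner ℝ y (Hm y) ∂μ ∂P) = 0) → (∀ Hm : EuclideanSpace ℝ (Fin 3) →L[ℝ] EuclideanSpace ℝ (Fin 3), 0 ≤ ∫ μ, ∫ y, (14 * ‖y‖⁻¹ ^ 16 - 8 * ‖y‖⁻¹ ^ 10) * inner ℝ y (Hm y) ^ 2 + (‖y‖⁻¹ ^ 8 - ‖y‖⁻¹ ^ 14) * ‖Hm y‖ ^ 2 ∂μ ∂P) → (¬ (∀ᵐ μ ∂P, ∀ s : EuclideanSpace ℝ (Fin 3), μ {s} ≠ 0 → s ≠ 0 → 1 ≤ ‖s‖)) → (∀ R : ℝ, δ ≤ R → 10 < δ * R → ∀ᵐ μ ∂P, ∀ y : EuclideanSpace ℝ (Fin 3), μ {y} ≠ 0 → 1 < μ (Metric.closedBall y R)) → (⨅ Q : Literature.MathematicalPhysics.StatisticalMechanics.PeriodicConfiguration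 3, Q.energyPerParticle Literature.MathematicalPhysics.StatisticalMechanics.lennardJones) < (∫ μ, Literature.MathematicalPhysics.StatisticalMechanics.rootEnergy Literature.MathematicalPhysics.StatisticalMechanics.lennardJones μ ∂P)) := by
  constructor
  · intro h δ hδ P
    have h' := h δ hδ P
    dsimp only at h' ⊢
    intro hP ha hb hd he h0 _ _ _ _ _ _ _ _
    exact h' hP ha hb hd he h0
  · intro h
    rw [aperiodicFrustratedLawGap_iff_unitDenseDifferences hU]
    intro δ hδ P
    have h' := h δ hδ P
    dsimp only at h' ⊢
    intro hP ha hb hd he h0 hD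
    by_contra hlt
    have hmin := not_lt.mp hlt
    obtain ⟨h₁, h₂, -⟩ := virial_of_minimising' hU hδ ha hb hmin
    exact hlt (h' hP ha hb hd he h0 hD h₁ h₂ (fun A => hmin.trans (eStar_le_integral_linearDeformed hU hδ ha hb A))
      (fun Hm => palmStress_of_minimising hU hδ ha hb hmin Hm) (fun Hm => bornStability_of_minimising hU hδ ha hb hmin Hm)
      (compressedRoot_of_minimising hU hδ ha hb hmin) fun R hδR hR => ae_forall_crowded_of_minimising hU hδ ha hb hmin hδR hR)

end Summit.AtomisticToContinuum.Crystallization.Theorems.FrustratedLawDichotomyAperiodicGapVirialCut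

end
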